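import Literature.NumberTheory.Rogawski1990.ArchStableSideChartReadG          -- ★ (4) READ-G II `stableOrbitalIntegralRel_gprimeTorus_eq_inv_boxMass_mul_sum`
import Literature.NumberTheory.Rogawski1990.ArchChartBoxCoherenceInner          -- ★ (4) FILE B (C′G)-inner: the two box masses agree
import Literature.NumberTheory.Rogawski1990.ArchInnerTransferCongruence          -- ★ (T-d) `archStableOrbitalIntegral_transport_archCongr`
import Literature.NumberTheory.Rogawski1990.ArchInnerTransferReadInnerSums       -- ★ (11) part 1 (this seat): chart sums, multiplicity
import HarnessLib

/-!
# READ-INNER, part 2 (N8-INNER brick (11) «JUNCTION», LH3-p03 (g7)): the two frames read at partner chart points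

Topic `NumberTheory/Rogawski1990`; namespace `Literature.NumberTheory.Rogawski1990`.  THEOREMS ONLY.  Cell `pub/hodgecm-mathlib`, crux H413
(`stmt-HodgeConjecture-24833`), road «N8-INNER» (row 2 `stub_N8`), brick (11) «JUNCTION», LAYER 2 (READ-INNER), part 2 of 3.

THE IDENTITY.  At a regular point `c` of a chart `S` admissible for the house frame `α` (so `gprimeTorus α S c ∈ G′_∞` and
`gprimeTorus β S c ∈ U(diag β)_∞ ≅ G_∞` are partners across the inner twist, ★ (3)), for a Weil-form frame `(m′, t′)` on `G′_∞` and a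
Weil-form frame `(m_β, t_β)` on the quasi-split atlas group whose torus data are (C′G)-coherent with a datum `t` on `U(H₂)` pushed along the
congruence `Φ` (★ FILE B's binders, token for token):
`Σ_ρ chartOrbG_β f (ρ·c) = κ · Σ_ρ chartOrbG_α a′ (ρ·c)` with `κ = ∏_{w definite for α} 3⁻¹`
⟹ `Φ^st_{m_β}(gprimeTorus β S c, f) = Φ^st_{m′}(gprimeTorus α S c, a′)`
— ★ READ-G at both frames, ★ the coincidence of the two box masses, and part 1's weight multiplicity.  With ★
`archStableOrbitalIntegral_transport_archCongr` the left side is `Φ^st_m(Φ⁻¹(gprimeTorus β S c), f ∘ Φ)` on `U(H₂) = U(Φ₃)`.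

References: Rogawski 1990 §4.1 (4.1.1), §4.3 (4.3.1), §14.2 (14.2.1); Shelstad 1979 §4 p. 20, Lemma 4.2.
-/

set_option autoImplicit false

noncomputable section

open MeasureTheory MeasureTheory.Measure NumberField NumberField.InfinitePlace Matrix Complex Topology Finset
open Literature.MeasureTheory.Group
open scoped MatrixGroups Matrix Classical NNReal ENNReal

namespace Literature.NumberTheory.Rogawski1990

open Literature.NumberTheory.Automorphic Literature.NumberTheory.Automorphic.UnitaryGroup Literature.NumberTheory.Automorphic.ArchCartan

section Frames

variable (L : Type) [Field L] [NumberField L] [IsCMField L] (α : Fin 3 → L)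
  [MeasurableSpace ↥(arch (↥(maximalRealSubfield L)) L (IsCMField.complexConj L) 3 (Matrix.diagonal α))] [BorelSpace ↥(arch (↥(maximalRealSubfield L)) L (IsCMField.complexConj L) 3 (Matrix.diagonal α))]
  (ν' : Measure ↥(arch (↥(maximalRealSubfield L)) L (IsCMField.complexConj L) 3 (Matrix.diagonal α))) [ν'.IsHaarMeasure] [ν'.IsMulRightInvariant]
  (S : Finset {w : InfinitePlace L // IsComplex w})
  -- orbit-quotient σ-algebras on `G′_∞` (binders; `borel` in the letter's frame)
  [qGP : ∀ γ' : ↥(arch (↥(maximalRealSubfield L)) L (IsCMField.complexConj L) 3 (Matrix.diagonal α)), MeasurableSpace (↥(arch (↥(maximalRealSubfield L)) L (IsCMField.complexConj L) 3 (Matrix.diagonal α)) ⧸ Subgroup.centralizer ({γ'} : Set ↥(arch (↥(maximalRealSubfield L)) L (IsCMField.complexConj L) 3 (Matrix.diagonal α))))]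
  [qbGP : ∀ γ' : ↥(arch (↥(maximalRealSubfield L)) L (IsCMField.complexConj L) 3 (Matrix.diagonal α)), BorelSpace (↥(arch (↥(maximalRealSubfield L)) L (IsCMField.complexConj L) 3 (Matrix.diagonal α)) ⧸ Subgroup.centralizer ({γ'} : Set ↥(arch (↥(maximalRealSubfield L)) L (IsCMField.complexConj L) 3 (Matrix.diagonal α))))]
  (m' : OrbitalMeasureFamily ↥(arch (↥(maximalRealSubfield L)) L (IsCMField.complexConj L) 3 (Matrix.diagonal α)))
  (t' : ∀ γ' : ↥(arch (↥(maximalRealSubfield L)) L (IsCMField.complexConj L) 3 (Matrix.diagonal α)), Measure (Subgroup.centralizer ({γ'} : Set ↥(arch (↥(maximalRealSubfield L)) L (IsCMField.complexConj L) 3 (Matrix.diagonal α)))))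
  (hd' : (Matrix.diagonal α).det ≠ 0)
  -- (W′)(C′) of ★ `ArchCompatibleFamiliesG` for the diagonal frame (the binders of ★ `classOrbitalIntegral_mul_measure_box_eq_chartOrbG`, token for token)
  (hW' : m'.IsQuotientOf (fun γ => IsRegularElt (γ.val : GL (Fin 3) (mixedEmbedding.mixedSpace L))) ν' t')
  (hC' : ∀ (γ₁ γ₂ : ↥(arch (↥(maximalRealSubfield L)) L (IsCMField.complexConj L) 3 (Matrix.diagonal α))) (h₁ : IsRegularElt (γ₁.val : GL (Fin 3) (mixedEmbedding.mixedSpace L)))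
      (hc : Corresponds (UnitaryGroup.conjMixed (↥(maximalRealSubfield L)) L (IsCMField.complexConj L))
        (UnitaryGroup.archFormOf L 3 (Matrix.diagonal α)) (UnitaryGroup.archFormOf L 3 (Matrix.diagonal α)) γ₁ γ₂),
      Measure.map ⇑(UnitaryGroup.archStableCentralizerEquiv L hd' hd' hc h₁) (t' γ₁) = t' γ₂)

variable
  [MeasurableSpace ↥(arch (↥(maximalRealSubfield L)) L (IsCMField.complexConj L) 3 (Matrix.diagonal ![(2 : L)⁻¹, 1, -(2 : L)⁻¹]))] [BorelSpace ↥(arch (↥(maximalRealSubfield L)) L (IsCMField.complexConj L) 3 (Matrix.diagonal ![(2 : L)⁻¹, 1, -(2 : L)⁻¹]))]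
  (νβ : Measure ↥(arch (↥(maximalRealSubfield L)) L (IsCMField.complexConj L) 3 (Matrix.diagonal ![(2 : L)⁻¹, 1, -(2 : L)⁻¹]))) [νβ.IsHaarMeasure] [νβ.IsMulRightInvariant]
  [qGβ : ∀ γ' : ↥(arch (↥(maximalRealSubfield L)) L (IsCMField.complexConj L) 3 (Matrix.diagonal ![(2 : L)⁻¹, 1, -(2 : L)⁻¹])), MeasurableSpace (↥(arch (↥(maximalRealSubfield L)) L (IsCMField.complexConj L) 3 (Matrix.diagonal ![(2 : L)⁻¹, 1, -(2 : L)⁻¹])) ⧸ Subgroup.centralizer ({γ'} : Set ↥(arch (↥(maximalRealSubfield L)) L (IsCMField.complexConj L) 3 (Matrix.diagonal ![(2 : L)⁻¹, 1, -(2 : L)⁻¹]))))]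
  [qbGβ : ∀ γ' : ↥(arch (↥(maximalRealSubfield L)) L (IsCMField.complexConj L) 3 (Matrix.diagonal ![(2 : L)⁻¹, 1, -(2 : L)⁻¹])), BorelSpace (↥(arch (↥(maximalRealSubfield L)) L (IsCMField.complexConj L) 3 (Matrix.diagonal ![(2 : L)⁻¹, 1, -(2 : L)⁻¹])) ⧸ Subgroup.centralizer ({γ'} : Set ↥(arch (↥(maximalRealSubfield L)) L (IsCMField.complexConj L) 3 (Matrix.diagonal ![(2 : L)⁻¹, 1, -(2 : L)⁻¹]))))]
  (mβ : OrbitalMeasureFamily ↥(arch (↥(maximalRealSubfield L)) L (IsCMField.complexConj L) 3 (Matrix.diagonal ![(2 : L)⁻¹, 1, -(2 : L)⁻¹])))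
  (tβ : ∀ γ' : ↥(arch (↥(maximalRealSubfield L)) L (IsCMField.complexConj L) 3 (Matrix.diagonal ![(2 : L)⁻¹, 1, -(2 : L)⁻¹])), Measure (Subgroup.centralizer ({γ'} : Set ↥(arch (↥(maximalRealSubfield L)) L (IsCMField.complexConj L) 3 (Matrix.diagonal ![(2 : L)⁻¹, 1, -(2 : L)⁻¹])))))
  (hdβ : (Matrix.diagonal ![(2 : L)⁻¹, 1, -(2 : L)⁻¹]).det ≠ 0)
  (hWβ : mβ.IsQuotientOf (fun γ => IsRegularElt (γ.val : GL (Fin 3) (mixedEmbedding.mixedSpace L))) νβ tβ)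
  (hCβ : ∀ (γ₁ γ₂ : ↥(arch (↥(maximalRealSubfield L)) L (IsCMField.complexConj L) 3 (Matrix.diagonal ![(2 : L)⁻¹, 1, -(2 : L)⁻¹]))) (h₁ : IsRegularElt (γ₁.val : GL (Fin 3) (mixedEmbedding.mixedSpace L)))
      (hc : Corresponds (UnitaryGroup.conjMixed (↥(maximalRealSubfield L)) L (IsCMField.complexConj L))
        (UnitaryGroup.archFormOf L 3 (Matrix.diagonal ![(2 : L)⁻¹, 1, -(2 : L)⁻¹])) (UnitaryGroup.archFormOf L 3 (Matrix.diagonal ![(2 : L)⁻¹, 1, -(2 : L)⁻¹])) γ₁ γ₂),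
      Measure.map ⇑(UnitaryGroup.archStableCentralizerEquiv L hdβ hdβ hc h₁) (tβ γ₁) = tβ γ₂)

variable
  {H₂ : Matrix (Fin 3) (Fin 3) L}
  [MeasurableSpace ↥(arch (↥(maximalRealSubfield L)) L (IsCMField.complexConj L) 3 H₂)] [BorelSpace ↥(arch (↥(maximalRealSubfield L)) L (IsCMField.complexConj L) 3 H₂)]
  (t : ∀ γ : ↥(arch (↥(maximalRealSubfield L)) L (IsCMField.complexConj L) 3 H₂), Measure (Subgroup.centralizer ({γ} : Set ↥(arch (↥(maximalRealSubfield L)) L (IsCMField.complexConj L) 3 H₂))))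
  (hd₂ : H₂.det ≠ 0)
  (T : GL (Fin 3) (mixedEmbedding.mixedSpace L))
  (Φ : arch (↥(maximalRealSubfield L)) L (IsCMField.complexConj L) 3 H₂ ≃ₜ* arch (↥(maximalRealSubfield L)) L (IsCMField.complexConj L) 3 (Matrix.diagonal ![(2 : L)⁻¹, 1, -(2 : L)⁻¹]))
  (hΦ : ∀ g : arch (↥(maximalRealSubfield L)) L (IsCMField.complexConj L) 3 H₂,
    ((Φ g : arch (↥(maximalRealSubfield L)) L (IsCMField.complexConj L) 3 (Matrix.diagonal ![(2 : L)⁻¹, 1, -(2 : L)⁻¹])) : GL (Fin 3) (mixedEmbedding.mixedSpace L)) =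
      T * (g : GL (Fin 3) (mixedEmbedding.mixedSpace L)) * T⁻¹)
  (hC'G : ∀ (γ' : ↥(arch (↥(maximalRealSubfield L)) L (IsCMField.complexConj L) 3 (Matrix.diagonal α))) (γ : ↥(arch (↥(maximalRealSubfield L)) L (IsCMField.complexConj L) 3 H₂))
      (h' : IsRegularElt (γ'.val : GL (Fin 3) (mixedEmbedding.mixedSpace L)))
      (hc : Corresponds (UnitaryGroup.conjMixed (↥(maximalRealSubfield L)) L (IsCMField.complexConj L))
        (UnitaryGroup.archFormOf L 3 (Matrix.diagonal α)) (UnitaryGroup.archFormOf L 3 H₂) γ' γ),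
      Measure.map ⇑(UnitaryGroup.archStableCentralizerEquiv L hd' hd₂ hc h') (t' γ') = t γ)
  (htβ : ∀ δ, tβ δ = Measure.map (subgroupCongrHomeomorph Φ.toMulEquiv (Subgroup.centralizer ({Φ.symm δ} : Set _)) (Subgroup.centralizer ({δ} : Set _))
    (forall_archCongr_mem_centralizer_iff L Φ (Φ.apply_symm_apply δ)) Φ.continuous Φ.symm.continuous) (t (Φ.symm δ)))


include hW' hC' hWβ hCβ hΦ hC'G htβ in
/-- **READ-INNER AT PARTNER CHART POINTS.**  Equality of the plain partner sums of the chart functionals (up to the multiplicity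
`κ = ∏_{w definite} 3⁻¹`) gives equality of the STABLE orbital integrals of `f` at `gprimeTorus β S c` and of `a′` at `gprimeTorus α S c`,
for Weil-form frames whose torus data are (C′G)-coherent across the inner twist. ★ READ-G at both frames + ★ equal box masses + the weight
multiplicity. [cite: Rogawski1990, §4.1 (4.1.1) p. 39; §4.3 (4.3.1) pp. 43–44; §14.2 (14.2.1) p. 232] [cite: Shelstad1979, §4 p. 20, Lemma 4.2 (p. 23)] -/
theorem archStableOrbitalIntegral_gprimeTorus_eq_of_sum_chartOrbG_eq (hα : ∀ i, α i ≠ 0)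
    (hherm : ∀ i, (IsCMField.complexConj L (α i) : L) = α i)
    (hhermβ : ∀ i, (IsCMField.complexConj L ((![(2 : L)⁻¹, 1, -(2 : L)⁻¹] : Fin 3 → L) i) : L) = (![(2 : L)⁻¹, 1, -(2 : L)⁻¹] : Fin 3 → L) i)
    (hSα : ∀ w, w ∈ S → w ∈ splitChartPlaces L α)
    {c : {w : InfinitePlace L // IsComplex w} → Fin 3 → ℝ} (hc : c ∈ ArchCartan.RegG S)
    (a' : ↥(arch (↥(maximalRealSubfield L)) L (IsCMField.complexConj L) 3 (Matrix.diagonal α)) → ℂ)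
    (f : ↥(arch (↥(maximalRealSubfield L)) L (IsCMField.complexConj L) 3 (Matrix.diagonal ![(2 : L)⁻¹, 1, -(2 : L)⁻¹])) → ℂ)
    (hsum : ∑ ρ ∈ partnerPerms S, chartOrbG L ![(2 : L)⁻¹, 1, -(2 : L)⁻¹] νβ S f (slotPerm ρ c) =
      (∏ _w ∈ Finset.univ.filter (fun w => ¬ IsIndefiniteAt (slotSign L α) w), (3 : ℂ)⁻¹) *
        ∑ ρ ∈ partnerPerms S, chartOrbG L α ν' S a' (slotPerm ρ c)) :
    archStableOrbitalIntegral L 3 (Matrix.diagonal ![(2 : L)⁻¹, 1, -(2 : L)⁻¹]) mβ f (gprimeTorus L ![(2 : L)⁻¹, 1, -(2 : L)⁻¹] S c) =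
      archStableOrbitalIntegral L 3 (Matrix.diagonal α) m' a' (gprimeTorus L α S c) := by
  have hβ : ∀ i, (![(2 : L)⁻¹, 1, -(2 : L)⁻¹] : Fin 3 → L) i ≠ 0 := quasiSplitWeights_ne_zero L
  have hSβ : ∀ w, w ∈ S → w ∈ splitChartPlaces L ![(2 : L)⁻¹, 1, -(2 : L)⁻¹] :=
    fun w _ => mem_splitChartPlaces_quasiSplitWeights L w
  rw [stableOrbitalIntegralRel_gprimeTorus_eq_inv_boxMass_mul_sum L _ νβ S mβ tβ hdβ hWβ hCβ hβ hhermβ hSβ hc f,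
    stableOrbitalIntegralRel_gprimeTorus_eq_inv_boxMass_mul_sum L α ν' S m' t' hd' hW' hC' hα hherm hSα hc a',
    ← toReal_map_t'_chartBoxImgG_eq_toReal_map_torusPush_chartBoxImgG_quasiSplit L α S t' t tβ hd' hd₂ T Φ hΦ hC'G htβ hSα hc
      (chartTorusG_eq_centralizer L α S hα hSα hc) (chartTorusG_eq_centralizer L _ S hβ hSβ hc),
    partnerWeight_eq_quasiSplit_mul_of_admissible L α hα hSα, hsum]
  ring

end Frames

end Literature.NumberTheory.Rogawski1990

end
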